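import Summits.ABC.IUTFork.Conditional.WRowHexLamSevenAllKEventually
import Summits.ABC.IUTFork.Conditional.WRowLicenceTripleEventually
import HarnessLib

/-!
# Branch C — the NUMBER-LEVEL typed [IUTchIII] Cor. 3.12 in READING (U) (`T.Cor312Of`) TRUE, UNIFORMLY IN `k`, at every genuine
# Θ-volume datum on EVERY HEX axis `λ_k = 1/2 + 2/7^k` at every prime `l` with `l² > 16·abc_k` (junction, abc-iut-C-cert-3 gen 5)

C scoreboard (abc-iut-C-cert-3 gen 5, INTAKE / CERTS pen). PROOF-ONLY junction file (no `def`, no new `Prop`, no instance, no notation;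
nothing re-typed). Inputs BY NAME: abc-iut-C-cert-1's «W:HEX-UNIFORM-K» U1 (`WRowHexLamSevenAllKEventually`, p529753: `isABCTriple_hexK`,
`lamSeven_eq_hexK`, `jInv_hexK_ne`) and abc-iut-C-cert-2's generic number-level wrappers `WRow.cor312Of_triple_of_sq_lt` /
`WRow.cor312Of_triple_of_primePow_lt` (`WRowLicenceTripleEventuallySharp`) and `WRow.cor312Of_triple_of_large` / `WRow.cor312Of_triple_eventually`
(`WRowLicenceTripleEventually`), themselves compositions of W-row-1's `WRow.licence_triple_unconditional` with this pen's
`GenuineK.cor312Of_of_licence` (p435505) and the K-level Θ-side bound (p447368).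

* `Hex.cor312Of_lamSeven_allK_of_sq_lt` — for EVERY `k ≥ 1` and EVERY prime `l` with `16·abc_k < l²` (`abc_k = (7^k+4)(7^k−4)·2·7^k`):
  `T.Cor312Of` at every genuine datum `T` over `(ratPoint λ_k, l)` — ONE theorem, symbolic in `k`;
* `Hex.cor312Of_lamSeven_allK_of_primePow_lt` — the SHARP form (every prime `l ≥ 5` with `p < l ∧ 4·p^{⌊v_p(abc_k)/2⌋} < l` for every odd prime
  `p ∣ abc_k`; the per-prime hypothesis kept symbolic in `k`, verbatim the generic wrapper's);
* `Hex.cor312Of_lamSeven_allK_of_large` (`4·abc_k < l`) and `Hex.cor312Of_lamSeven_allK_eventually` (`∃ L, ∀ prime l ≥ L, ∀ T, T.Cor312Of`).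

READING (numbers, no side): on every HEX axis the window certificates' number-binder instance (K, LINE-FREE) is a THEOREM at every genuine
datum at every prime level above an explicit closed-form threshold in `k`; the exact per-axis thresholds `L⁺(k)` (`k ≤ 24`, files
`AbcOfSCor312OfHexBands{,B}` / `…CeilLevels` / `…InhLevels{D,E}`) are far below `4·√abc_k` and remain the R-W table's business. NO height bound
follows (known triples; `log q` of every HEX datum ≪ the content locus); cone binder untouched (C-R52); records UNCHANGED; inhabited-as-typed ≠
true-in-print; non-emptiness / admissibility / (P6) at these levels NOT claimed here; typed ≠ proved; instantiated ≠ endorsed; not a claim that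
abc is proved or refuted; no side taken on [IUTchIII] Cor 3.12 / [IUTchIV] Thm 1.10 or on any author.
[cite: Mochizuki2012, IUTchIII Cor. 3.12 p. 173–174, Step (xi-f) p. 184; IUTchIV Thm. 1.10 p. 22–23, Cor. 2.2 (ii) proof (P5)(P7) p. 46; IUTchI Ex. 3.2 (iv) p. 71]
[cite: DupuyHilado2025, §3.3, §3.4] [claim: Mochizuki2012, status: disputed]
-/

noncomputable section

open Set Function Metric NumberField IsDedekindDomain

namespace Summit.ABC.IUTFork.Conditional

open Thm311 Thm311.Real Cor312 Cor312Vol Cor312Prov Literature.IUT.LogThetaLattice Literature.IUT.LogVolume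
  Literature.IUT.HodgeTheaters Literature.IUT.LogVolume.Cor22
open Literature.NumberTheory.NumberFields Literature.NumberTheory.GaloisRepresentations.Ultrametric
open Literature.NumberTheory.DiophantineGeometry Literature.NumberTheory.DiophantineGeometry.GenEll

/-- **(U) on EVERY HEX axis, uniformly in `k`**: for every `k ≥ 1` and every prime `l` with `16·abc_k < l²`, the number-level typed Cor. 3.12
in reading (U) holds at every genuine Θ-volume datum over `(ratPoint (1/2 + 2/7^k), l)` — abc-iut-C-cert-2's `WRow.cor312Of_triple_of_sq_lt` at
abc-iut-C-cert-1's `isABCTriple_hexK` / `jInv_hexK_ne`, carrier rewritten by `lamSeven_eq_hexK`. No height bound; no side taken.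
[cite: Mochizuki2012, IUTchIII Cor. 3.12 p. 173–174; IUTchIV Cor. 2.2 (ii) proof (P5) p. 46] [claim: Mochizuki2012, status: disputed] -/
theorem Hex.cor312Of_lamSeven_allK_of_sq_lt {k l : ℕ} (hk : 1 ≤ k) (hl : l.Prime)
    (hbig : 16 * ((7 ^ k + 4) * (7 ^ k - 4) * (2 * 7 ^ k)) < l ^ 2)
    (T : Cor22.ThetaVolumeDatumAt (ratPoint ((2 : ℚ)⁻¹ + 2 / 7 ^ k)) l) : T.Cor312Of := by
  revert T
  rw [lamSeven_eq_hexK]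
  intro T
  exact WRow.cor312Of_triple_of_sq_lt (isABCTriple_hexK hk) (jInv_hexK_ne hk) hl hbig T

/-- **(U) on EVERY HEX axis, SHARP form, uniformly in `k`**: for every `k ≥ 1` and every prime `l ≥ 5` such that every odd prime `p ∣ abc_k`
satisfies `p < l ∧ 4·p^{⌊v_p(abc_k)/2⌋} < l` (hypothesis kept symbolic in `k`), `T.Cor312Of` at every genuine datum over `(ratPoint λ_k, l)` —
abc-iut-C-cert-2's `WRow.cor312Of_triple_of_primePow_lt` at `isABCTriple_hexK` / `jInv_hexK_ne`. No height bound; no side taken.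
[cite: Mochizuki2012, IUTchIII Cor. 3.12 p. 173–174; IUTchIV Prop. 1.2 (i)(ii) p. 10, Cor. 2.2 (ii) proof (P5) p. 46] [claim: Mochizuki2012, status: disputed] -/
theorem Hex.cor312Of_lamSeven_allK_of_primePow_lt {k l : ℕ} (hk : 1 ≤ k) (hl : l.Prime) (hl5 : 5 ≤ l)
    (hbad : ∀ p : ℕ, p.Prime → p ∣ (7 ^ k + 4) * (7 ^ k - 4) * (2 * 7 ^ k) → p ≠ 2 →
      p < l ∧ 4 * p ^ (((7 ^ k + 4) * (7 ^ k - 4) * (2 * 7 ^ k)).factorization p / 2) < l)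
    (T : Cor22.ThetaVolumeDatumAt (ratPoint ((2 : ℚ)⁻¹ + 2 / 7 ^ k)) l) : T.Cor312Of := by
  revert T
  rw [lamSeven_eq_hexK]
  intro T
  exact WRow.cor312Of_triple_of_primePow_lt (isABCTriple_hexK hk) (jInv_hexK_ne hk) hl hl5 hbad T

/-- **(U) on EVERY HEX axis at every prime `l > 4·abc_k`, uniformly in `k`** — abc-iut-C-cert-2's `WRow.cor312Of_triple_of_large` at
`isABCTriple_hexK` / `jInv_hexK_ne`. No height bound; no side taken.
[cite: Mochizuki2012, IUTchIII Cor. 3.12 p. 173–174; IUTchIV Cor. 2.2 (ii) proof (P5) p. 46] [claim: Mochizuki2012, status: disputed] -/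
theorem Hex.cor312Of_lamSeven_allK_of_large {k l : ℕ} (hk : 1 ≤ k) (hl : l.Prime)
    (hbig : 4 * ((7 ^ k + 4) * (7 ^ k - 4) * (2 * 7 ^ k)) < l)
    (T : Cor22.ThetaVolumeDatumAt (ratPoint ((2 : ℚ)⁻¹ + 2 / 7 ^ k)) l) : T.Cor312Of := by
  revert T
  rw [lamSeven_eq_hexK]
  intro T
  exact WRow.cor312Of_triple_of_large (isABCTriple_hexK hk) (jInv_hexK_ne hk) hl hbig T

/-- **COFINITENESS IN `l` ON EVERY HEX AXIS (reading (U)), uniformly in `k`**: for every `k ≥ 1` there is an explicit `L` (`= 4·abc_k + 1`)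
with `T.Cor312Of` at every genuine Θ-datum of `(ratPoint λ_k, l)` for every prime `l ≥ L` — abc-iut-C-cert-2's `WRow.cor312Of_triple_eventually`
at `isABCTriple_hexK` / `jInv_hexK_ne`. No height bound; no side taken.
[cite: Mochizuki2012, IUTchIII Cor. 3.12 p. 173–174] [claim: Mochizuki2012, status: disputed] -/
theorem Hex.cor312Of_lamSeven_allK_eventually {k : ℕ} (hk : 1 ≤ k) :
    ∃ L : ℕ, ∀ l : ℕ, l.Prime → L ≤ l → ∀ T : Cor22.ThetaVolumeDatumAt (ratPoint ((2 : ℚ)⁻¹ + 2 / 7 ^ k)) l, T.Cor312Of := by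
  rw [lamSeven_eq_hexK]
  exact WRow.cor312Of_triple_eventually (isABCTriple_hexK hk) (jInv_hexK_ne hk)

end Summit.ABC.IUTFork.Conditional

end
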